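import Summits.BirchSwinnertonDyer.BirchSwinnertonDyer.Theorems.Rank2ObservatoryTamagawaIstarLocal
import HarnessLib

/-!
# BSD rank ≥ 2 observatory (`b2b-bsdr2`, cert-2 gen 11): EXACT local Tamagawa numbers for the
# Kodaira types `Iₙ*` (`n ≥ 1`) — part 2: reading the side-`D` point off the LAST round's quadratic

HONEST FRAMING: per-curve certified theorems and census instruments; no claim on BSD in rank ≥ 2.

Theorems only (no named fact, no axiom).  Part 1 (`Rank2ObservatoryTamagawaIstarLocal`) proved, over
a Henselian DVR `R` in the `Iₙ*` normal form, `[E(K) : E₀(K)] = 4` if some `R`-point `(πx₁, π²y₂)`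
has `x₁ ∈ 𝔪` ("side `D`") and `= 2` if none has.  Tate's sub-procedure (LNM 476 §7; Silverman
*ATAEC* IV.9.4 Step 7) translates `y`, `x`, `y`, … alternately until the quadratic of a round is
SEPARABLE; the round-`m` normal forms are
* odd exit `n = 2m + 1`: `π ∣ a₁`, `a₂ = πp` (`p ∈ Rˣ`), `a₃ = π^{m+2}A₃`, `π^{m+3} ∣ a₄`,
  `a₆ = π^{2m+4}A₆`, quadratic `Y² + A₃Y − A₆` (`A₃² + 4A₆ ∉ 𝔪`);
* even exit `n = 2m + 2`: `π ∣ a₁`, `a₂ = πp`, `π^{m+3} ∣ a₃`, `a₄ = π^{m+3}A₄`, `a₆ = π^{2m+5}A₆`,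
  quadratic `pX² + A₄X + A₆` (`A₄² − 4pA₆ ∉ 𝔪`).
This file proves, by "valuation climbing" (`pow_dvd_X_of_equation`: an `R`-point with `π² ∣ x` has
`π^{i+2} ∣ x` for all `i ≤ m`) and part 1's `pow_succ_dvd_of_dvd_mul_add`:
* `residue_root_of_sideD_odd/even`: a side-`D` point forces a residue ROOT of the exit quadratic;
* `exists_sideD_odd/even` (`R` Henselian): a residue root Hensel-lifts to a side-`D` point — in the even
  case through the tree's Hensel lemma for NON-monic polynomials applied to `π^{m+1}X³ + pX² + A₄X + A₆`;
* the four local theorems `index_Istar_odd_eq_four/two`, `index_Istar_even_eq_four/two`: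
  `c = [E(K) : E₀(K)] = 4` iff the exit quadratic has a residue root, `= 2` iff not — exactly Tate's
  rule (Silverman *ATAEC* IV.9.4 Step 7: "`c = 4` if the roots are in `k`, else `c = 2`").
Part 3 (`Rank2ObservatoryTamagawaIstarIntCast`) specialises to integer models at `p`.
References: [Tate1975] J. Tate, LNM 476 (1975) §7; [Silverman1994] [SilvermanATAEC1994] J. H.
Silverman, GTM 151 (1994), IV.9.4 Step 7, Table 4.1; [Cassels1986] J. W. S. Cassels, *Local Fields*
(1986), Ch. 4 Lemma 3.1 (Hensel for a simple approximate root).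
-/

set_option linter.dupNamespace false
set_option autoImplicit false

noncomputable section

open scoped Classical

open Polynomial IsLocalRing WeierstrassCurve
  Literature.NumberTheory.EllipticCurves Literature.NumberTheory.EllipticCurves.LocalIndex
  Literature.NumberTheory.DiophantineGeometry Literature.NumberTheory.DiophantineGeometry.TateAlgorithm

namespace Summit.BirchSwinnertonDyer.BirchSwinnertonDyer.Rank2Observatory.Tam

section Level

variable {R : Type*} [CommRing R] [IsDomain R] [IsDiscreteValuationRing R]
  {K : Type*} [Field K] [Algebra R K] [IsFractionRing R K]

/-! ### Reading a point of side `D` in the residue field: the LAST round's quadratic has a root -/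

/-- **Odd exit (`n = 2m + 1`), a side-`D` point gives a residue root.**  In the normal form of round
`m` of Tate's sub-procedure — `π ∣ a₁`, `a₂ = πp` (`p ∈ Rˣ`), `a₃ = π^{m+2}A₃`, `π^{m+3} ∣ a₄`,
`a₆ = π^{2m+4}A₆` — an `R`-point `(x, y)` with `π² ∣ x` has `π^{m+2} ∣ x` (climbing), then
`π^{m+2} ∣ y`, and `Y = y/π^{m+2}` reduces to a root of `Y² + Ā₃Y − Ā₆`.
[cite: Tate1975, §7] [cite: Silverman1994, IV.9.4 Step 7] -/
theorem residue_root_of_sideD_odd (J : WeierstrassCurve R) {ϖ : R} (hϖ : Irreducible ϖ) {m : ℕ}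
    (h1 : ϖ ∣ J.a₁) {p A₃ A₆ : R} (hp : J.a₂ = ϖ * p) (hpu : IsUnit p)
    (hγ : J.a₃ = ϖ ^ (m + 2) * A₃) (h4 : ϖ ^ (m + 3) ∣ J.a₄)
    (hε : J.a₆ = ϖ ^ (2 * (m + 2)) * A₆) {x y : R} (hx : ϖ ^ 2 ∣ x)
    (heq : J.toAffine.Equation x y) :
    ∃ Y : R, residue R Y ^ 2 + residue R A₃ * residue R Y - residue R A₆ = 0 := by
  have hres0 : residue R ϖ = 0 := residue_uniformizer_eq_zero hϖ
  obtain ⟨X, rfl⟩ : ϖ ^ (m + 2) ∣ x := pow_dvd_X_of_equation J hϖ h1 hp hpu ⟨_, hγ⟩ h4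
    ((pow_dvd_pow ϖ (by omega)).trans ⟨A₆, hε⟩) hx heq m le_rfl
  rw [WeierstrassCurve.Affine.equation_iff] at heq
  obtain ⟨α, hα⟩ := h1
  obtain ⟨A₄, hA₄⟩ := h4
  have hc : ϖ ^ (m + 1 + 1) ∣ J.a₁ * (ϖ ^ (m + 2) * X) + J.a₃ := by
    rw [hα, hγ]; exact ⟨ϖ * α * X + A₃, by ring⟩
  have hprod : y * (y + (J.a₁ * (ϖ ^ (m + 2) * X) + J.a₃)) =
      ϖ ^ (2 * (m + 2)) * (ϖ ^ (m + 2) * X ^ 3 + ϖ * p * X ^ 2 + ϖ * A₄ * X + A₆) := by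
    have e : y * (y + (J.a₁ * (ϖ ^ (m + 2) * X) + J.a₃)) = (ϖ ^ (m + 2) * X) ^ 3 +
        J.a₂ * (ϖ ^ (m + 2) * X) ^ 2 + J.a₄ * (ϖ ^ (m + 2) * X) + J.a₆ := by
      linear_combination heq
    rw [e, hp, hA₄, hε]; ring
  have hy : ϖ ^ (m + 1 + 1) ∣ y := pow_succ_dvd_of_dvd_mul_add hϖ (m + 1) hc (by
    rw [hprod]; exact Dvd.dvd.mul_right (pow_dvd_pow ϖ (by omega)) _)
  obtain ⟨Y, rfl⟩ := hy
  refine ⟨Y, ?_⟩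
  have key : Y * (Y + (ϖ * α * X + A₃)) =
      ϖ ^ (m + 2) * X ^ 3 + ϖ * p * X ^ 2 + ϖ * A₄ * X + A₆ := by
    refine mul_left_cancel₀ (pow_ne_zero (2 * (m + 2)) hϖ.ne_zero) ?_
    rw [← hprod, hα, hγ]; ring
  have := congrArg (residue R) key
  simp only [map_add, map_mul, map_pow, hres0, zero_mul, zero_add,
    zero_pow (show m + 2 ≠ 0 by omega)] at this
  linear_combination this

/-- **Even exit (`n = 2m + 2`), a side-`D` point gives a residue root.**  In the normal form of round
`m` — `π ∣ a₁`, `a₂ = πp` (`p ∈ Rˣ`), `π^{m+3} ∣ a₃`, `a₄ = π^{m+3}A₄`, `a₆ = π^{2m+5}A₆` — an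
`R`-point `(x, y)` with `π² ∣ x` has `π^{m+2} ∣ x`, `π^{m+3} ∣ y`, and `X = x/π^{m+2}` reduces to a
root of `p̄X² + Ā₄X + Ā₆`. [cite: Tate1975, §7] [cite: Silverman1994, IV.9.4 Step 7] -/
theorem residue_root_of_sideD_even (J : WeierstrassCurve R) {ϖ : R} (hϖ : Irreducible ϖ) {m : ℕ}
    (h1 : ϖ ∣ J.a₁) {p A₄ A₆ : R} (hp : J.a₂ = ϖ * p) (hpu : IsUnit p)
    (h3 : ϖ ^ (m + 3) ∣ J.a₃) (hδ : J.a₄ = ϖ ^ (m + 3) * A₄)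
    (hε : J.a₆ = ϖ ^ (2 * m + 5) * A₆) {x y : R} (hx : ϖ ^ 2 ∣ x)
    (heq : J.toAffine.Equation x y) :
    ∃ X : R, residue R p * residue R X ^ 2 + residue R A₄ * residue R X + residue R A₆ = 0 := by
  have hres0 : residue R ϖ = 0 := residue_uniformizer_eq_zero hϖ
  obtain ⟨X, rfl⟩ : ϖ ^ (m + 2) ∣ x := pow_dvd_X_of_equation J hϖ h1 hp hpu
    ((pow_dvd_pow ϖ (by omega)).trans h3) ⟨_, hδ⟩
    ((pow_dvd_pow ϖ (by omega)).trans ⟨A₆, hε⟩) hx heq m le_rfl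
  rw [WeierstrassCurve.Affine.equation_iff] at heq
  obtain ⟨α, hα⟩ := h1
  obtain ⟨A₃, hA₃⟩ := h3
  have hc : ϖ ^ (m + 2 + 1) ∣ J.a₁ * (ϖ ^ (m + 2) * X) + J.a₃ := by
    rw [hα, hA₃]; exact ⟨α * X + A₃, by ring⟩
  have hprod : y * (y + (J.a₁ * (ϖ ^ (m + 2) * X) + J.a₃)) =
      ϖ ^ (2 * m + 5) * (ϖ ^ (m + 1) * X ^ 3 + p * X ^ 2 + A₄ * X + A₆) := by
    have e : y * (y + (J.a₁ * (ϖ ^ (m + 2) * X) + J.a₃)) = (ϖ ^ (m + 2) * X) ^ 3 +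
        J.a₂ * (ϖ ^ (m + 2) * X) ^ 2 + J.a₄ * (ϖ ^ (m + 2) * X) + J.a₆ := by
      linear_combination heq
    rw [e, hp, hδ, hε]; ring
  have hy : ϖ ^ (m + 2 + 1) ∣ y := pow_succ_dvd_of_dvd_mul_add hϖ (m + 2) hc (by
    rw [hprod]; exact Dvd.dvd.mul_right (pow_dvd_pow ϖ (by omega)) _)
  obtain ⟨Y, rfl⟩ := hy
  refine ⟨X, ?_⟩
  have key : ϖ * (Y * (Y + (α * X + A₃))) = ϖ ^ (m + 1) * X ^ 3 + p * X ^ 2 + A₄ * X + A₆ := by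
    refine mul_left_cancel₀ (pow_ne_zero (2 * m + 5) hϖ.ne_zero) ?_
    rw [← hprod, hα, hA₃]; ring
  have := congrArg (residue R) key
  simp only [map_add, map_mul, map_pow, hres0, zero_mul, zero_add,
    zero_pow (show m + 1 ≠ 0 by omega)] at this
  linear_combination -this

/-! ### Conversely a residue root Hensel-lifts to a point of side `D` -/

omit [IsDomain R] [IsDiscreteValuationRing R] in
/-- **Odd exit, a residue root gives a side-`D` point** (`R` Henselian): with `a₃ = π^{m+2}A₃`,
`a₆ = π^{2m+4}A₆` and `A₃² + 4A₆ ∉ 𝔪`, an approximate root `y₀` of `Y² + A₃Y − A₆` lifts to a root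
`y` (Hensel, unit derivative `2y₀ + A₃`), and `(0, π^{m+2}y)` is an `R`-point with `x = π · 0`.
[cite: Tate1975, §7] [cite: Silverman1994, IV.9.4 Step 7] -/
theorem exists_sideD_odd [HenselianLocalRing R] (J : WeierstrassCurve R) {ϖ : R} {m : ℕ}
    {A₃ A₆ : R} (hγ : J.a₃ = ϖ ^ (m + 2) * A₃) (hε : J.a₆ = ϖ ^ (2 * (m + 2)) * A₆)
    (hdisc : A₃ ^ 2 + 4 * A₆ ∉ maximalIdeal R) {y₀ : R}
    (hy₀ : y₀ ^ 2 + A₃ * y₀ - A₆ ∈ maximalIdeal R) :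
    ∃ x₁ y₂ : R, x₁ ∈ maximalIdeal R ∧ J.toAffine.Equation (ϖ * x₁) (ϖ ^ 2 * y₂) := by
  obtain ⟨y, hy⟩ := exists_root_quadratic_of_henselian hdisc hy₀
  refine ⟨0, ϖ ^ m * y, Ideal.zero_mem _, ?_⟩
  rw [WeierstrassCurve.Affine.equation_iff]
  change (ϖ ^ 2 * (ϖ ^ m * y)) ^ 2 + J.a₁ * (ϖ * 0) * (ϖ ^ 2 * (ϖ ^ m * y)) +
      J.a₃ * (ϖ ^ 2 * (ϖ ^ m * y)) = (ϖ * 0) ^ 3 + J.a₂ * (ϖ * 0) ^ 2 + J.a₄ * (ϖ * 0) + J.a₆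
  rw [hγ, hε]
  linear_combination ϖ ^ (2 * (m + 2)) * hy

/-- **Even exit, a residue root gives a side-`D` point** (`R` Henselian): with `a₂ = πp` (`p ∈ Rˣ`),
`a₄ = π^{m+3}A₄`, `a₆ = π^{2m+5}A₆` and `A₄² − 4pA₆ ∉ 𝔪`, an approximate root `x₀` of
`pX² + A₄X + A₆` is simple (`(2px₀ + A₄)² = (A₄² − 4pA₆) + 4p(px₀² + A₄x₀ + A₆)`), so the NON-MONIC
cubic `π^{m+1}X³ + pX² + A₄X + A₆` has a root `X` near it (tree: Hensel for arbitrary polynomials,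
`HenselianLocalRing.exists_isRoot_of_isUnit_derivative`), and `(π^{m+2}X, 0)` is an `R`-point with
`x/π ∈ 𝔪`. [cite: Tate1975, §7] [cite: Cassels1986, Ch. 4 Lemma 3.1] -/
theorem exists_sideD_even [HenselianLocalRing R] (J : WeierstrassCurve R) {ϖ : R}
    (hϖ : Irreducible ϖ) {m : ℕ} {p A₄ A₆ : R} (hp : J.a₂ = ϖ * p)
    (hδ : J.a₄ = ϖ ^ (m + 3) * A₄) (hε : J.a₆ = ϖ ^ (2 * m + 5) * A₆)
    (hdisc : A₄ ^ 2 - 4 * p * A₆ ∉ maximalIdeal R) {x₀ : R}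
    (hx₀ : p * x₀ ^ 2 + A₄ * x₀ + A₆ ∈ maximalIdeal R) :
    ∃ x₁ y₂ : R, x₁ ∈ maximalIdeal R ∧ J.toAffine.Equation (ϖ * x₁) (ϖ ^ 2 * y₂) := by
  have hm : ϖ ∈ maximalIdeal R := (IsLocalRing.mem_maximalIdeal _).mpr hϖ.not_isUnit
  set g : R[X] := C (ϖ ^ (m + 1)) * X ^ 3 + C p * X ^ 2 + C A₄ * X + C A₆ with hg
  have hev : ∀ t, g.eval t = ϖ ^ (m + 1) * t ^ 3 + p * t ^ 2 + A₄ * t + A₆ := by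
    intro t; simp only [hg, eval_add, eval_mul, eval_C, eval_pow, eval_X]
  have hev' : ∀ t, g.derivative.eval t = (2 * p * t + A₄) + ϖ * (3 * ϖ ^ m * t ^ 2) := by
    intro t
    simp only [hg, derivative_add, derivative_C_mul, derivative_X_pow, derivative_X,
      derivative_C, eval_add, eval_mul, eval_C, eval_pow, eval_X, Nat.cast_ofNat, mul_one, add_zero]
    ring
  have h₁ : g.eval x₀ ∈ maximalIdeal R := by
    rw [hev, show ϖ ^ (m + 1) * x₀ ^ 3 + p * x₀ ^ 2 + A₄ * x₀ + A₆ =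
      ϖ * (ϖ ^ m * x₀ ^ 3) + (p * x₀ ^ 2 + A₄ * x₀ + A₆) by ring]
    exact Ideal.add_mem _ (Ideal.mul_mem_right _ _ hm) hx₀
  have h₂ : IsUnit (g.derivative.eval x₀) := by
    rw [hev']
    refine isUnit_add_mul_of_isUnit hϖ (IsLocalRing.notMem_maximalIdeal.mp fun h2 => hdisc ?_) _
    have e : A₄ ^ 2 - 4 * p * A₆ =
        (2 * p * x₀ + A₄) * (2 * p * x₀ + A₄) - 4 * p * (p * x₀ ^ 2 + A₄ * x₀ + A₆) := by ring
    rw [e]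
    exact Ideal.sub_mem _ (Ideal.mul_mem_left _ _ h2) (Ideal.mul_mem_left _ _ hx₀)
  obtain ⟨t, ht, -⟩ := HenselianLocalRing.exists_isRoot_of_isUnit_derivative g x₀ h₁ h₂
  have ht' : ϖ ^ (m + 1) * t ^ 3 + p * t ^ 2 + A₄ * t + A₆ = 0 := by rw [← hev]; exact ht
  refine ⟨ϖ ^ (m + 1) * t, 0,
    Ideal.mul_mem_right _ _ (Ideal.pow_mem_of_mem _ hm (m + 1) (Nat.succ_pos m)), ?_⟩
  rw [WeierstrassCurve.Affine.equation_iff]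
  change (ϖ ^ 2 * 0) ^ 2 + J.a₁ * (ϖ * (ϖ ^ (m + 1) * t)) * (ϖ ^ 2 * 0) + J.a₃ * (ϖ ^ 2 * 0) =
    (ϖ * (ϖ ^ (m + 1) * t)) ^ 3 + J.a₂ * (ϖ * (ϖ ^ (m + 1) * t)) ^ 2 +
      J.a₄ * (ϖ * (ϖ ^ (m + 1) * t)) + J.a₆
  rw [hp, hδ, hε]
  linear_combination (-(ϖ ^ (2 * m + 5))) * ht'

/-! ### The four local theorems -/

/-- The memberships of the `Iₙ*` normal form from `a₁ = πα`, `a₂ = πp` (`p ∈ Rˣ`), `π² ∣ a₃`,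
`π³ ∣ a₄`, `π⁴ ∣ a₆`. [folklore] -/
theorem normalForm_Istar_mem (J : WeierstrassCurve R) {ϖ α p : R} (hϖ : Irreducible ϖ)
    (hα : J.a₁ = ϖ * α) (hp : J.a₂ = ϖ * p) (hpu : IsUnit p) (h3 : ϖ ^ 2 ∣ J.a₃)
    (h4 : ϖ ^ 3 ∣ J.a₄) (h6 : ϖ ^ 4 ∣ J.a₆) :
    J.a₁ ∈ maximalIdeal R ∧ J.a₂ ∈ maximalIdeal R ∧ J.a₂ ∉ maximalIdeal R ^ 2 ∧
      J.a₃ ∈ maximalIdeal R ^ 2 ∧ J.a₄ ∈ maximalIdeal R ^ 3 ∧ J.a₆ ∈ maximalIdeal R ^ 4 := by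
  refine ⟨(mem_maximalIdeal_iff_dvd_of_irreducible hϖ _).mpr ⟨α, hα⟩,
    (mem_maximalIdeal_iff_dvd_of_irreducible hϖ _).mpr ⟨p, hp⟩, fun h => hϖ.not_isUnit ?_,
    (mem_maximalIdeal_pow_iff_dvd_of_irreducible hϖ _ 2).mpr h3,
    (mem_maximalIdeal_pow_iff_dvd_of_irreducible hϖ _ 3).mpr h4,
    (mem_maximalIdeal_pow_iff_dvd_of_irreducible hϖ _ 4).mpr h6⟩
  have h2 := (mem_maximalIdeal_pow_iff_dvd_of_irreducible hϖ _ 2).mp h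
  rw [hp, pow_two, mul_dvd_mul_iff_left hϖ.ne_zero] at h2
  exact isUnit_of_dvd_unit h2 hpu

/-- **`Iₙ*`, odd exit, a root ⟹ `[E(K) : E₀(K)] = 4`** (`R` Henselian): round-`m` normal form with the
uniformizer `π`, `Δ ≠ 0`, `A₃² + 4A₆ ∉ 𝔪`, and an approximate root of `Y² + A₃Y − A₆`.
[cite: Tate1975, §7] [cite: Silverman1994, IV.9.4 Step 7] -/
theorem index_Istar_odd_eq_four [HenselianLocalRing R] (J : WeierstrassCurve R) {m : ℕ}
    {α p A₃ A₄ A₆ : R} (hα : J.a₁ = uniformizer R * α) (hp : J.a₂ = uniformizer R * p)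
    (hpu : IsUnit p) (hγ : J.a₃ = uniformizer R ^ (m + 2) * A₃)
    (hδ : J.a₄ = uniformizer R ^ (m + 3) * A₄) (hε : J.a₆ = uniformizer R ^ (2 * (m + 2)) * A₆)
    (hΔ : J.Δ ≠ 0) (hdisc : A₃ ^ 2 + 4 * A₆ ∉ maximalIdeal R) {y₀ : R}
    (hy₀ : y₀ ^ 2 + A₃ * y₀ - A₆ ∈ maximalIdeal R) :
    (J.nonsingularReductionSubgroup (integers_valuationRing_valuation R K)).index = 4 := by
  have hϖ : Irreducible (uniformizer R) := irreducible_uniformizer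
  obtain ⟨h1, h2, h2', h3, h4, h6⟩ := normalForm_Istar_mem J hϖ hα hp hpu
    ((pow_dvd_pow _ (by omega)).trans ⟨A₃, hγ⟩) ((pow_dvd_pow _ (by omega)).trans ⟨A₄, hδ⟩)
    ((pow_dvd_pow _ (by omega)).trans ⟨A₆, hε⟩)
  obtain ⟨x₁, y₂, hx₁, heq⟩ := exists_sideD_odd J hγ hε hdisc hy₀
  exact index_eq_four_of_sideD J hΔ h1 h2 h2' h3 h4 h6 hx₁ heq

/-- **`Iₙ*`, odd exit, no root ⟹ `[E(K) : E₀(K)] = 2`** (`R` Henselian): round-`m` normal form with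
the uniformizer, `Δ ≠ 0`, and `Y² + Ā₃Y − Ā₆` without root in the residue field.
[cite: Tate1975, §7] [cite: Silverman1994, IV.9.4 Step 7] -/
theorem index_Istar_odd_eq_two [HenselianLocalRing R] (J : WeierstrassCurve R) {m : ℕ}
    {α p A₃ A₄ A₆ : R} (hα : J.a₁ = uniformizer R * α) (hp : J.a₂ = uniformizer R * p)
    (hpu : IsUnit p) (hγ : J.a₃ = uniformizer R ^ (m + 2) * A₃)
    (hδ : J.a₄ = uniformizer R ^ (m + 3) * A₄) (hε : J.a₆ = uniformizer R ^ (2 * (m + 2)) * A₆)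
    (hΔ : J.Δ ≠ 0) (hno : ∀ y : ResidueField R, y ^ 2 + residue R A₃ * y - residue R A₆ ≠ 0) :
    (J.nonsingularReductionSubgroup (integers_valuationRing_valuation R K)).index = 2 := by
  have hϖ : Irreducible (uniformizer R) := irreducible_uniformizer
  obtain ⟨h1, h2, h2', h3, h4, h6⟩ := normalForm_Istar_mem J hϖ hα hp hpu
    ((pow_dvd_pow _ (by omega)).trans ⟨A₃, hγ⟩) ((pow_dvd_pow _ (by omega)).trans ⟨A₄, hδ⟩)
    ((pow_dvd_pow _ (by omega)).trans ⟨A₆, hε⟩)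
  refine index_eq_two_of_no_sideD J hΔ h1 h2 h2' h3 h4 h6 fun x₁ y₂ hx₁ heq => ?_
  obtain ⟨x', hx'⟩ := mem_maximalIdeal_iff_dvd.mp hx₁
  obtain ⟨Y, hY⟩ := residue_root_of_sideD_odd J hϖ ⟨α, hα⟩ hp hpu hγ ⟨A₄, hδ⟩ hε
    (x := uniformizer R * x₁) (by rw [hx', pow_two]; exact mul_dvd_mul_left _ (Dvd.intro _ rfl)) heq
  exact hno _ hY

/-- **`Iₙ*`, even exit, a root ⟹ `[E(K) : E₀(K)] = 4`** (`R` Henselian): round-`m` normal form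
(`π^{m+3} ∣ a₃`, `a₄ = π^{m+3}A₄`, `a₆ = π^{2m+5}A₆`), `Δ ≠ 0`, `A₄² − 4pA₆ ∉ 𝔪`, and an
approximate root of `pX² + A₄X + A₆`. [cite: Tate1975, §7] [cite: Silverman1994, IV.9.4 Step 7] -/
theorem index_Istar_even_eq_four [HenselianLocalRing R] (J : WeierstrassCurve R) {m : ℕ}
    {α p A₃ A₄ A₆ : R} (hα : J.a₁ = uniformizer R * α) (hp : J.a₂ = uniformizer R * p)
    (hpu : IsUnit p) (hγ : J.a₃ = uniformizer R ^ (m + 3) * A₃)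
    (hδ : J.a₄ = uniformizer R ^ (m + 3) * A₄) (hε : J.a₆ = uniformizer R ^ (2 * m + 5) * A₆)
    (hΔ : J.Δ ≠ 0) (hdisc : A₄ ^ 2 - 4 * p * A₆ ∉ maximalIdeal R) {x₀ : R}
    (hx₀ : p * x₀ ^ 2 + A₄ * x₀ + A₆ ∈ maximalIdeal R) :
    (J.nonsingularReductionSubgroup (integers_valuationRing_valuation R K)).index = 4 := by
  have hϖ : Irreducible (uniformizer R) := irreducible_uniformizer
  obtain ⟨h1, h2, h2', h3, h4, h6⟩ := normalForm_Istar_mem J hϖ hα hp hpu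
    ((pow_dvd_pow _ (by omega)).trans ⟨A₃, hγ⟩) ((pow_dvd_pow _ (by omega)).trans ⟨A₄, hδ⟩)
    ((pow_dvd_pow _ (by omega)).trans ⟨A₆, hε⟩)
  obtain ⟨x₁, y₂, hx₁, heq⟩ := exists_sideD_even J hϖ hp hδ hε hdisc hx₀
  exact index_eq_four_of_sideD J hΔ h1 h2 h2' h3 h4 h6 hx₁ heq

/-- **`Iₙ*`, even exit, no root ⟹ `[E(K) : E₀(K)] = 2`** (`R` Henselian): round-`m` normal form,
`Δ ≠ 0`, and `p̄X² + Ā₄X + Ā₆` without root in the residue field.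
[cite: Tate1975, §7] [cite: Silverman1994, IV.9.4 Step 7] -/
theorem index_Istar_even_eq_two [HenselianLocalRing R] (J : WeierstrassCurve R) {m : ℕ}
    {α p A₃ A₄ A₆ : R} (hα : J.a₁ = uniformizer R * α) (hp : J.a₂ = uniformizer R * p)
    (hpu : IsUnit p) (hγ : J.a₃ = uniformizer R ^ (m + 3) * A₃)
    (hδ : J.a₄ = uniformizer R ^ (m + 3) * A₄) (hε : J.a₆ = uniformizer R ^ (2 * m + 5) * A₆)
    (hΔ : J.Δ ≠ 0)
    (hno : ∀ x : ResidueField R, residue R p * x ^ 2 + residue R A₄ * x + residue R A₆ ≠ 0) :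
    (J.nonsingularReductionSubgroup (integers_valuationRing_valuation R K)).index = 2 := by
  have hϖ : Irreducible (uniformizer R) := irreducible_uniformizer
  obtain ⟨h1, h2, h2', h3, h4, h6⟩ := normalForm_Istar_mem J hϖ hα hp hpu
    ((pow_dvd_pow _ (by omega)).trans ⟨A₃, hγ⟩) ((pow_dvd_pow _ (by omega)).trans ⟨A₄, hδ⟩)
    ((pow_dvd_pow _ (by omega)).trans ⟨A₆, hε⟩)
  refine index_eq_two_of_no_sideD J hΔ h1 h2 h2' h3 h4 h6 fun x₁ y₂ hx₁ heq => ?_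
  obtain ⟨x', hx'⟩ := mem_maximalIdeal_iff_dvd.mp hx₁
  obtain ⟨X, hX⟩ := residue_root_of_sideD_even J hϖ ⟨α, hα⟩ hp hpu ⟨A₃, hγ⟩ hδ hε
    (x := uniformizer R * x₁) (by rw [hx', pow_two]; exact mul_dvd_mul_left _ (Dvd.intro _ rfl)) heq
  exact hno _ hX

end Level

end Summit.BirchSwinnertonDyer.BirchSwinnertonDyer.Rank2Observatory.Tam

end
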